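import Literature.Probability.RandomPlanarGeometry.HexSAWPolygonCellsRayTopLeaf
import Literature.Probability.RandomPlanarGeometry.HexSAWPolygonCellsOmegaBase
import Literature.Probability.RandomPlanarGeometry.HexSAWPolygonCellsPeelPolygon
import HarnessLib

/-!
# Cell calculus for honeycomb polygon surgery, XXXIX: the injectivity induction of THEOREM I, modulo the CASE-2 readings

Topic `Literature/Probability/RandomPlanarGeometry` (lane «pcv-sawmu», a-p4 g22; sequel of XXX `…OmegaBase` (`omegaImage`, `base_data`, `omega_hX`) and
XXXIII–XXXVIII (closed form, peel stability, `ι (S − c) = ι S − w`, stick tops, CASE 1, ray tops are leaves)).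

THEOREM I of `HOME/pub-sawmu-a-p4/g21/omega/THEOREM-OMEGA-g21.md` §4 is «`ι` is injective on admissible brick sets». This file assembles the strong
induction on `#S₁` from the mechanised CASE 1 (the lex-largest hexagon `w` of `W = ι S₁ = ι S₂` lies outside both base images: remove the stick tops under
`w`, apply the induction hypothesis to `ι (S₁ − c₁) = W − w = ι (S₂ − c₂)`, recover `c₁ = c₂` by (P3)) and takes the two remaining ingredients as
HYPOTHESES (inlined ∀-statements; edition 1 names them `Case2Reading` / `Case1Exclusive`), stated exactly as the heir has to prove them (HANDOFF-gen22.md §3 (b) (R2)/(R3)):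
* hypothesis (R2) «CASE-2 reading» — if `w` lies in the base image of `S₁` (CASE 2 of §4) then `S₁ = S₂` given the induction hypothesis below `#S₁` (the five readings of
  §4 CASE 2: X, R, RU-leaf, RU-flip, C₂);
* hypothesis (R3) «CASE-1 exclusivity» — if `w` lies outside the base image of `S₁` it lies outside that of `S₂` (§4: a ray top is a leaf — XXXVIII — and does not match the
  RU-walk; the top of a base image is thick or matches the RU-walk).
Main statement: ★★ `omegaImage_injective_of_readings`. The admissible class `Adm` (brick set, polygonal `bdry`, `#peel ≥ 2`) is closed under removing a
stick top (`Adm.erase_stickTop`, from XXXIV/XXXVI).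

Sources: N. Madras, G. Slade, *The Self-Avoiding Walk* (1993), §3.2, proof of Theorem 3.2.3 [MadrasSlade1993]; I. Jensen, J. Phys.: Conf. Ser. 42 (2006) 163
[Jensen2006HoneycombPolygons].  Label (lane): LANE INFRASTRUCTURE for the lane's step-two injection; nothing new in writing.
-/

open Finset

namespace Literature.Probability.RandomPlanarGeometry.SAW

namespace HexCell

/-- The admissible class of THEOREM I: brick sets with polygonal boundary whose base has at least two hexagons.
[cite: MadrasSlade1993, §3.2 (proof of Theorem 3.2.3)] -/
def Adm (S : Finset Cell) : Prop := IsBrickSet S ∧ IsPolygon brickWallGraph (bdry S) ∧ 2 ≤ #(peel S)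

/-- The recursion hypotheses of THEOREM V hold for an admissible set: no peeled hexagon on an exceptional host, base ports `PortInv`, base image `+2`.
[cite: MadrasSlade1993, §3.2 (proof of Theorem 3.2.3)] -/
theorem Adm.data {S : Finset Cell} (h : Adm S) :
    (∀ c ∈ S \ peel S, LL c ∉ baseExc (peel S)) ∧ PortInv (baseExc (peel S)) (peel S) (baseImage (peel S)) (basePort (peel S)) ∧
      perim (baseImage (peel S)) = perim (peel S) + 2 := by
  obtain ⟨hS, hP, h2⟩ := h
  have hfix : peel (peel S) = peel S := peel_eq_self_iff.2 (not_exists_peelable_peel S)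
  obtain ⟨hinv, hperim, -⟩ := base_data (isBrickSet_peel hS) (isPolygon_bdry_peel hS hP) h2 hfix
  exact ⟨omega_hX hS, hinv, hperim⟩

/-- An admissible set with a peeled hexagon has perimeter `≥ 7`. [cite: MadrasSlade1993, §3.2 (proof of Theorem 3.2.3)] -/
theorem Adm.seven_le_perim {S : Finset Cell} {c : Cell} (hc : c ∈ S \ peel S) : 7 ≤ perim S := by
  obtain ⟨m₀, hm₀⟩ := exists_peelable_of_mem_sdiff_peel hc
  exact seven_le_perim_of_isSpikeTop hm₀.1

/-- ★ The admissible class is closed under removing a stick top. [cite: MadrasSlade1993, §3.2 (proof of Theorem 3.2.3)] -/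
theorem Adm.erase_stickTop {S : Finset Cell} (h : Adm S) {c : Cell} (hc : c ∈ S \ peel S) (hur : UR c ∉ S) : Adm (S.erase c) := by
  obtain ⟨hS, hP, h2⟩ := h
  refine ⟨fun x hx => hS x (mem_of_mem_erase hx), isPolygon_bdry_erase_stickTop hS hP (Adm.seven_le_perim hc) hc hur, ?_⟩
  rw [peel_erase_of_stickTop hS h2 hc hur]; exact h2

/-- `omegaImage` unfolds to the recursion with the base data of XXX. [cite: MadrasSlade1993, §3.2 (proof of Theorem 3.2.3)] -/
theorem omegaImage_eq (S : Finset Cell) : omegaImage S = (omegaRec baseImage basePort S).1 := rfl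

/-- The image of an admissible set is nonempty (its perimeter is `perim S + 2 ≥ 9`). [cite: MadrasSlade1993, §3.2 (proof of Theorem 3.2.3)] -/
theorem Adm.omegaImage_nonempty {S : Finset Cell} (h : Adm S) (hc : ∃ c, c ∈ S \ peel S) : (omegaImage S).Nonempty := by
  obtain ⟨c, hc⟩ := hc
  have h7 := Adm.seven_le_perim hc
  have hp := (theoremV h.1 h.2.1 h.2.2).2.1
  rw [nonempty_iff_ne_empty]
  intro he
  rw [he, perim_empty] at hp
  omega

/-- ★★ **THEOREM I modulo the CASE-2 readings**: with (R2) and (R3), `ι = omegaImage` is injective on the admissible class. The CASE-1 branch is fully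
proved here: stick tops under the common top ray hexagon (XXXVII `exists_stickTop_of_lexmax_image`), `ι (S − c) = ι S − w` (XXXV), induction, host
recovery (XXXVII `eq_of_erase_stickTop_eq`). [cite: MadrasSlade1993, §3.2 (proof of Theorem 3.2.3)] -/
theorem omegaImage_injective_of_readings
    (hR2 : (∀ S₁ S₂ : Finset Cell, ∀ w : Cell, Adm S₁ → Adm S₂ → omegaImage S₁ = omegaImage S₂ → IsLexmax (omegaImage S₁) w →
        w ∈ baseImage (peel S₁) →
        (∀ T₁ T₂ : Finset Cell, Adm T₁ → Adm T₂ → #T₁ < #S₁ → omegaImage T₁ = omegaImage T₂ → T₁ = T₂) → S₁ = S₂))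
    (hR3 : (∀ S₁ S₂ : Finset Cell, ∀ w : Cell, Adm S₁ → Adm S₂ → omegaImage S₁ = omegaImage S₂ → IsLexmax (omegaImage S₁) w →
        w ∉ baseImage (peel S₁) → w ∉ baseImage (peel S₂))) :
    ∀ S₁ S₂ : Finset Cell, Adm S₁ → Adm S₂ → omegaImage S₁ = omegaImage S₂ → S₁ = S₂ := by
  classical
  intro S₁
  induction hn : #S₁ using Nat.strong_induction_on generalizing S₁ with
  | _ n ih =>
    intro S₂ h₁ h₂ heq
    have IH : ∀ T₁ T₂ : Finset Cell, Adm T₁ → Adm T₂ → #T₁ < #S₁ → omegaImage T₁ = omegaImage T₂ → T₁ = T₂ :=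
      fun T₁ T₂ hT₁ hT₂ hlt hTeq => ih (#T₁) (hn ▸ hlt) T₁ rfl T₂ hT₁ hT₂ hTeq
    -- is anything peeled at all?  If `S₁` is its own base, use the CASE-2 reading (the top of `ι S₁` lies in the base image, which is all of `ι S₁`).
    by_cases hpe : ∃ c, c ∈ S₁ \ peel S₁
    swap
    · -- `S₁ = peel S₁`: `omegaImage S₁ = baseImage (peel S₁)`
      push Not at hpe
      have hsd : S₁ \ peel S₁ = ∅ := eq_empty_of_forall_notMem hpe
      have hW : omegaImage S₁ = baseImage (peel S₁) := by
        rw [omegaImage_eq, omegaRec_image_eq, hsd, image_empty, union_empty]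
      -- the image is nonempty: it has perimeter `perim S₁ + 2 ≥ 2`… use the base image's `+2` over a nonempty base
      have hne : (omegaImage S₁).Nonempty := by
        rw [nonempty_iff_ne_empty]; intro he
        have hp := (theoremV h₁.1 h₁.2.1 h₁.2.2).2.1
        have hp0 : perim (peel S₁) ≤ perim S₁ := by rw [perim_eq_perim_peel_add S₁]; omega
        have h3 : 3 ≤ perim (peel S₁) := by
          rw [← card_bdry (isBrickSet_peel h₁.1)]
          exact three_le_card_of_isPolygon (isPolygon_bdry_peel h₁.1 h₁.2.1)
        rw [he, perim_empty] at hp; omega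
      obtain ⟨w, hw⟩ := exists_isLexmax hne
      exact hR2 S₁ S₂ w h₁ h₂ heq hw (by rw [← hW]; exact hw.1) IH
    obtain ⟨w, hw⟩ := exists_isLexmax (h₁.omegaImage_nonempty hpe)
    by_cases hwC : w ∈ baseImage (peel S₁)
    · exact hR2 S₁ S₂ w h₁ h₂ heq hw hwC IH
    · -- CASE 1 for both
      have hwC₂ : w ∉ baseImage (peel S₂) := hR3 S₁ S₂ w h₁ h₂ heq hw hwC
      have hw₂ : IsLexmax (omegaImage S₂) w := heq ▸ hw
      obtain ⟨hX₁, hb₁, hC₁⟩ := h₁.data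
      obtain ⟨hX₂, hb₂, hC₂⟩ := h₂.data
      obtain ⟨c₁, hc₁, hur₁, hw₁⟩ := exists_stickTop_of_lexmax_image (C := baseImage) (P₀ := basePort) hw.1 hwC hw.2
      obtain ⟨c₂, hc₂, hur₂, hw₂'⟩ := exists_stickTop_of_lexmax_image (C := baseImage) (P₀ := basePort) hw₂.1 hwC₂ hw₂.2
      have e₁ : omegaImage (S₁.erase c₁) = (omegaImage S₁).erase w := by
        rw [hw₁]; exact omegaRec_image_erase_stickTop h₁.1 h₁.2.2 hX₁ hb₁ hc₁ hur₁
      have e₂ : omegaImage (S₂.erase c₂) = (omegaImage S₂).erase w := by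
        rw [hw₂']; exact omegaRec_image_erase_stickTop h₂.1 h₂.2.2 hX₂ hb₂ hc₂ hur₂
      have hT : S₁.erase c₁ = S₂.erase c₂ :=
        IH _ _ (h₁.erase_stickTop hc₁ hur₁) (h₂.erase_stickTop hc₂ hur₂) (card_erase_lt_of_mem (mem_sdiff.1 hc₁).1)
          (by rw [e₁, e₂, heq])
      have hpeel : peel S₁ = peel S₂ := by
        rw [← peel_erase_of_stickTop h₁.1 h₁.2.2 hc₁ hur₁, hT, peel_erase_of_stickTop h₂.1 h₂.2.2 hc₂ hur₂]
      -- same exceptional set, then host recovery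
      have hX₂' : ∀ c ∈ S₂ \ peel S₂, LL c ∉ baseExc (peel S₁) := fun c hc => by rw [hpeel]; exact hX₂ c hc
      exact eq_of_erase_stickTop_eq h₁.1 h₂.1 h₁.2.2 h₂.2.2 hX₁ hX₂' hb₁ hc₁ hur₁ hc₂ hur₂ hT (by rw [← hw₁, ← hw₂'])

end HexCell

end Literature.Probability.RandomPlanarGeometry.SAW
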